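import Summits.CriticalPhenomena.PercolationContinuityZ3.Theorems.PercNearOneGluingNoHeavyLowerTailSahiCombTriWCylinder
import Summits.CriticalPhenomena.PercolationContinuityZ3.Theorems.PercNearOneGluingNoHeavyLowerTailSahiCombTriWCoatoms

/-!
# CYLINDER CLOSURE of `TriWIneq`: moving a dummy fibre coordinate into the index cube can only DECREASE `TRI_W`

Support file of the one-cut programme (crux `NoHeavyLowerTail`, stmt-CriticalPhenomena-4575; TRI lane of cell `prim-masterthm`,
seat P5 gen 25; memo `FROM-prim-masterthm-p5-g25-CYLINDER-CLOSURE.md`).  Continuation of `…SahiCombTriWCylinder` (prim-lf-1 gen 40: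
`optLo`, `optHi`, `optCyl`, the cylinder lemma for sandwich CERTIFICATES).

That file observes that the functional `triW` itself is not invariant when a dummy fibre coordinate of the test set is moved to the index
cube.  Here we prove that it is MONOTONE: for every test family `P ⊆ Finset γ`, every index cube `Finset β` and all families
`F, G : Finset β → Finset (Finset (Option γ))` of the big fibre cube, re-reading the SAME families with the extra fibre coordinate as an extra
INDEX coordinate (`moveIdx F : Finset (Option β) → Finset (Finset γ)`, `moveIdx F (x.map some) = (F x)₀`, `moveIdx F (insertNone x) = (F x)₁`)
gives the exact identity

  `triW (optCyl P) F G = triW P (moveIdx F) (moveIdx G) + Σ_x [#(P∩A₁∩B₁) + #(P∩A₀∩B₀) − #(P∩A₀∩B₁) − #(P∩A₁∩B₀)]`,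
  `A_i = refl ((F x)_i)`, `B_i = refl ((G xᶜ)_i)`                                                        (`triW_optCyl_eq`)

(four of the five counts of `triWTerm` split additively over the two sections; the doubly antipodal count `#(P ∩ refl(F x) ∩ refl(G xᶜ))` is
ALIGNED on the cylinder side and CROSSED on the moved side), and the bracket is `≥ 0` for up-sets by the rearrangement inequality
`card_cross_le_card_aligned` (`A₀ ⊆ A₁`, `B₀ ⊆ B₁`).  Hence

* **`triW_moveIdx_le`** — `triW P (moveIdx F) (moveIdx G) ≤ triW (optCyl P) F G` (the "Ω-form ladder" of P5 gen 12 in the tree's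
  two-cube language: in the product cube the only term of `TRI` that sees the index/fibre split is `#(ρ𝒫 ∩ 𝔽 ∩ S_I 𝔾)`, which decreases when
  the flipped block `I` grows — fibrewise Kleitman);
* **`triW_nonneg_optCyl_of_forall`** — CYLINDER CLOSURE: if `0 ≤ triW P F' G'` for EVERY index cube and all monotone families of
  up-sets, then the same holds for the cylinder `optCyl P` (one dummy coordinate; iterate for more).  So the class of test sets on which
  `TriWIneq` holds is closed under cylinders, a minimal counterexample to `TriWIneq` has no dummy coordinate, and every unconditional
  `P`-stratum of the tree extends to all its cylinders — with no certificate needed (compare `triW_nonneg_optCyl_of_sandwichCert`,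
  which lifts sandwich certificates);
* corollary: **`triW_nonneg_optCyl_coatomFamily`** (cylinders over the co-atom stratum `{#wᶜ ≤ 1}` of `…TriWCoatoms`, a non-saturated
  threshold family — new cells in every dimension).  (On top of the computational file `…TriWCylinderFour` the same one-liner gives the
  dimension-7 cylinders over every up-set of `2^4`; omitted here to keep this file on the standard axioms.)
HONEST LABEL: an exact identity, one rearrangement inequality, and the resulting closure property; `TriWIneq` itself stays OPEN. [this work]
-/

namespace Summit.CriticalPhenomena.PercolationContinuityZ3.Theorems

namespace FiveUpSet

open Finset

variable {β γ : Type} [DecidableEq β] [Fintype β] [DecidableEq γ] [Fintype γ]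

/-! ### Re-reading a family of the big fibre cube with the dummy coordinate as an index coordinate -/

/-- The moved family: for `F : Finset β → Finset (Finset (Option γ))`, `moveIdx F : Finset (Option β) → Finset (Finset γ)` reads the LOWER
section `(F x)₀` at the index point `x.map some` (new index coordinate absent) and the UPPER section `(F x)₁` at `insertNone x`
(new index coordinate present). [this work] -/
def moveIdx (F : Finset β → Finset (Finset (Option γ))) : Finset (Option β) → Finset (Finset γ) :=
  fun y => if none ∈ y then optHi (F (Finset.eraseNone y)) else optLo (F (Finset.eraseNone y))

omit [Fintype β] in
/-- The moved family at a lower index point is the lower section. [this work] -/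
@[simp] theorem moveIdx_map_some (F : Finset β → Finset (Finset (Option γ))) (x : Finset β) :
    moveIdx F (x.map Function.Embedding.some) = optLo (F x) := by
  unfold moveIdx
  rw [if_neg (by simp), Finset.eraseNone_map_some]

omit [Fintype β] in
/-- The moved family at an upper index point is the upper section. [this work] -/
@[simp] theorem moveIdx_insertNone (F : Finset β → Finset (Finset (Option γ))) (x : Finset β) :
    moveIdx F (Finset.insertNone x) = optHi (F x) := by
  unfold moveIdx
  rw [if_pos (by simp), Finset.eraseNone_insertNone]

omit [Fintype β] in
/-- The moved family of a family of up-sets is a family of up-sets. [this work] -/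
theorem isUpperSet_moveIdx {F : Finset β → Finset (Finset (Option γ))} (hF : ∀ x, IsUpperSet (F x : Set (Finset (Option γ))))
    (y : Finset (Option β)) : IsUpperSet (moveIdx F y : Set (Finset γ)) := by
  unfold moveIdx
  split_ifs
  · exact isUpperSet_optHi (hF _)
  · exact isUpperSet_optLo (hF _)

omit [Fintype β] [DecidableEq β] in
/-- Sections are monotone in the family. [this work] -/
theorem optLo_mono {A A' : Finset (Finset (Option γ))} (h : A ⊆ A') : optLo A ⊆ optLo A' := by
  intro s hs
  rw [mem_optLo] at hs ⊢
  exact h hs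

omit [Fintype β] [DecidableEq β] in
/-- The upper section is monotone in the family. [this work] -/
theorem optHi_mono {A A' : Finset (Finset (Option γ))} (h : A ⊆ A') : optHi A ⊆ optHi A' := by
  intro s hs
  rw [mem_optHi] at hs ⊢
  exact h hs

omit [Fintype β] in
/-- The moved family of a monotone family of up-sets is monotone (the step from the lower to the upper copy of an index point uses
`(F x)₀ ⊆ (F x)₁`, i.e. that `F x` is an up-set). [this work] -/
theorem monotone_moveIdx {F : Finset β → Finset (Finset (Option γ))} (hF : ∀ x, IsUpperSet (F x : Set (Finset (Option γ))))
    (hFm : Monotone F) : Monotone (moveIdx F) := by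
  intro y y' hyy
  have he : Finset.eraseNone y ⊆ Finset.eraseNone y' := Finset.eraseNone.monotone hyy
  unfold moveIdx
  by_cases hy : none ∈ y
  · have hy' : none ∈ y' := hyy hy
    rw [if_pos hy, if_pos hy']
    exact optHi_mono (hFm he)
  · rw [if_neg hy]
    by_cases hy' : none ∈ y'
    · rw [if_pos hy']
      exact (optLo_subset_optHi (hF _)).trans (optHi_mono (hFm he))
    · rw [if_neg hy']
      exact optLo_mono (hFm he)

/-! ### The term identity -/

/-- The rearrangement bracket at the index point `x`:
`#(P∩A₁∩B₁) + #(P∩A₀∩B₀) − #(P∩A₀∩B₁) − #(P∩A₁∩B₀)` with `A_i = refl ((F x)_i)`, `B_i = refl ((G xᶜ)_i)`. [this work] -/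
def sectionGap (P : Finset (Finset γ)) (F G : Finset β → Finset (Finset (Option γ))) (x : Finset β) : ℤ :=
  (((P ∩ refl (optHi (F x)) ∩ refl (optHi (G xᶜ))).card : ℤ) + (P ∩ refl (optLo (F x)) ∩ refl (optLo (G xᶜ))).card)
    - (P ∩ refl (optLo (F x)) ∩ refl (optHi (G xᶜ))).card - (P ∩ refl (optHi (F x)) ∩ refl (optLo (G xᶜ))).card

omit [Fintype β] [DecidableEq β] in
/-- `refl` is monotone for inclusion (local copy of `…TriWGenU.refl_subset_refl`). [this work] -/
private theorem refl_subset_refl' {𝒜 ℬ : Finset (Finset γ)} (h : 𝒜 ⊆ ℬ) : refl 𝒜 ⊆ refl ℬ := by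
  intro s hs
  rw [mem_refl] at hs ⊢
  exact h hs

/-- The rearrangement bracket is non-negative when `F x` and `G xᶜ` are up-sets (`card_cross_le_card_aligned`). [this work] -/
theorem sectionGap_nonneg (P : Finset (Finset γ)) {F G : Finset β → Finset (Finset (Option γ))}
    (hF : ∀ x, IsUpperSet (F x : Set (Finset (Option γ)))) (hG : ∀ x, IsUpperSet (G x : Set (Finset (Option γ)))) (x : Finset β) :
    0 ≤ sectionGap P F G x := by
  unfold sectionGap
  have h := card_cross_le_card_aligned P (refl (optLo (F x))) (refl (optHi (F x))) (refl (optLo (G xᶜ))) (refl (optHi (G xᶜ)))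
    (refl_subset_refl' (optLo_subset_optHi (hF x))) (refl_subset_refl' (optLo_subset_optHi (hG xᶜ)))
  have h' : (((P ∩ refl (optHi (F x)) ∩ refl (optLo (G xᶜ))).card : ℤ) + (P ∩ refl (optLo (F x)) ∩ refl (optHi (G xᶜ))).card)
      ≤ (P ∩ refl (optLo (F x)) ∩ refl (optLo (G xᶜ))).card + (P ∩ refl (optHi (F x)) ∩ refl (optHi (G xᶜ))).card := by
    exact_mod_cast h
  linarith

/-- **Term identity.**  The summand of `triW (optCyl P) F G` at `x` is the sum of the two summands of `triW P (moveIdx F) (moveIdx G)` at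
`x.map some` and `insertNone x`, plus the rearrangement bracket: four of the five counts split additively over the sections
(`card_optCyl_inter_inter`, `optLo_refl`, `optHi_refl`), the doubly antipodal count is aligned on the left and crossed on the right. [this work] -/
theorem triWTerm_optCyl (P : Finset (Finset γ)) (F G : Finset β → Finset (Finset (Option γ))) (x : Finset β) :
    triWTerm (optCyl P) F G x
      = triWTerm P (moveIdx F) (moveIdx G) (x.map Function.Embedding.some)
        + triWTerm P (moveIdx F) (moveIdx G) (Finset.insertNone x) + sectionGap P F G x := by
  unfold triWTerm sectionGap
  simp only [compl_map_some, compl_insertNone, moveIdx_map_some, moveIdx_insertNone, card_optCyl_inter_inter, optLo_refl, optHi_refl]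
  push_cast
  ring

/-! ### Summing over the index cube with one more coordinate -/

omit [DecidableEq γ] [Fintype γ] in
/-- A sum over `Finset (Option β)` splits into the lower and the upper copy of `Finset β`. [this work] -/
theorem sum_finset_option_idx (f : Finset (Option β) → ℤ) :
    ∑ y, f y = ∑ x : Finset β, f (x.map Function.Embedding.some) + ∑ x : Finset β, f (Finset.insertNone x) := by
  rw [← sum_filter_add_sum_filter_not univ (fun t : Finset (Option β) => none ∉ t)]
  congr 1
  · symm
    refine sum_bij' (fun s _ => s.map Function.Embedding.some) (fun t _ => Finset.eraseNone t) ?_ ?_ ?_ ?_ ?_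
    · intro s _
      rw [mem_filter]
      exact ⟨mem_univ _, by simp⟩
    · intro t _
      exact mem_univ _
    · intro s _
      exact Finset.eraseNone_map_some s
    · intro t ht
      rw [mem_filter] at ht
      rw [Finset.map_some_eraseNone, erase_eq_of_notMem ht.2]
    · intro s _
      rfl
  · symm
    refine sum_bij' (fun s _ => Finset.insertNone s) (fun t _ => Finset.eraseNone t) ?_ ?_ ?_ ?_ ?_
    · intro s _
      rw [mem_filter]
      exact ⟨mem_univ _, by simp⟩
    · intro t _
      exact mem_univ _
    · intro s _
      exact Finset.eraseNone_insertNone s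
    · intro t ht
      rw [mem_filter, not_not] at ht
      rw [Finset.insertNone_eraseNone, insert_eq_of_mem ht.2]
    · intro s _
      rfl

/-- **The identity**: `triW (optCyl P) F G = triW P (moveIdx F) (moveIdx G) + Σ_x sectionGap P F G x`. [this work] -/
theorem triW_optCyl_eq (P : Finset (Finset γ)) (F G : Finset β → Finset (Finset (Option γ))) :
    triW (optCyl P) F G = triW P (moveIdx F) (moveIdx G) + ∑ x : Finset β, sectionGap P F G x := by
  unfold triW
  rw [sum_finset_option_idx, ← sum_add_distrib, ← sum_add_distrib]
  exact sum_congr rfl fun x _ => triWTerm_optCyl P F G x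

/-- **Monotonicity ("Ω-form ladder")**: moving a dummy fibre coordinate of the test set into the index cube can only decrease `TRI_W`:
`triW P (moveIdx F) (moveIdx G) ≤ triW (optCyl P) F G` for families of up-sets `F, G`. [this work] -/
theorem triW_moveIdx_le (P : Finset (Finset γ)) {F G : Finset β → Finset (Finset (Option γ))}
    (hF : ∀ x, IsUpperSet (F x : Set (Finset (Option γ)))) (hG : ∀ x, IsUpperSet (G x : Set (Finset (Option γ)))) :
    triW P (moveIdx F) (moveIdx G) ≤ triW (optCyl P) F G := by
  rw [triW_optCyl_eq]
  have h : 0 ≤ ∑ x : Finset β, sectionGap P F G x := sum_nonneg fun x _ => sectionGap_nonneg P hF hG x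
  linarith

/-! ### Cylinder closure of the `TriWIneq` class -/

/-- **CYLINDER CLOSURE.**  If `0 ≤ triW P F' G'` for EVERY index cube `Finset β'` and all monotone families of up-sets `F', G'` of
`Finset γ`, then `0 ≤ triW (optCyl P) F G` for every index cube and all monotone families of up-sets of `Finset (Option γ)`: apply the
hypothesis to the moved families on the index cube `Finset (Option β)` and use `triW_moveIdx_le`. [this work] -/
theorem triW_nonneg_optCyl_of_forall {P : Finset (Finset γ)}
    (h : ∀ (β' : Type) [DecidableEq β'] [Fintype β'] (F' G' : Finset β' → Finset (Finset γ)),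
      (∀ y, IsUpperSet (F' y : Set (Finset γ))) → (∀ y, IsUpperSet (G' y : Set (Finset γ))) →
      Monotone F' → Monotone G' → 0 ≤ triW P F' G')
    (F G : Finset β → Finset (Finset (Option γ)))
    (hF : ∀ x, IsUpperSet (F x : Set (Finset (Option γ)))) (hG : ∀ x, IsUpperSet (G x : Set (Finset (Option γ))))
    (hFm : Monotone F) (hGm : Monotone G) :
    0 ≤ triW (optCyl P) F G :=
  (h (Option β) (moveIdx F) (moveIdx G) (isUpperSet_moveIdx hF) (isUpperSet_moveIdx hG)
    (monotone_moveIdx hF hFm) (monotone_moveIdx hG hGm)).trans (triW_moveIdx_le P hF hG)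

/-- **Cylinders over the co-atom stratum.**  For `#γ ≥ 3` and the threshold family `coatomFamily γ = {w | #wᶜ ≤ 1}` (`…TriWCoatoms`,
`triW_nonneg_coatomFamily`), every cylinder `optCyl (coatomFamily γ) ⊆ Finset (Option γ)` ("at least `#γ − 1` of the first `#γ` coordinates,
the last one free" — for `#γ ≥ 4` neither a threshold nor a saturated family of the big cube) satisfies `TriWIneq` for every index cube. [this work] -/
theorem triW_nonneg_optCyl_coatomFamily (hγ : 3 ≤ Fintype.card γ) (F G : Finset β → Finset (Finset (Option γ)))
    (hF : ∀ x, IsUpperSet (F x : Set (Finset (Option γ)))) (hG : ∀ x, IsUpperSet (G x : Set (Finset (Option γ))))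
    (hFm : Monotone F) (hGm : Monotone G) :
    0 ≤ triW (optCyl (coatomFamily γ)) F G :=
  triW_nonneg_optCyl_of_forall (fun _ _ _ F' G' hF' hG' hF'm hG'm => triW_nonneg_coatomFamily hγ F' G' hF' hG' hF'm hG'm)
    F G hF hG hFm hGm

/-! ## Appendix (gen 25, v2): the converse and the iterate

* `cylFam`, `triW_optCyl_cylFam` (doubling identity `triW (optCyl P) (cylFam F) (cylFam G) = 2 · triW P F G`) and `triW_nonneg_of_optCyl`:
  `TriWIneq (optCyl P) → TriWIneq P` on the same index cube — so over all index cubes `TriWIneq P ↔ TriWIneq (optCyl P)`;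
* `OptPow γ k` (`k`-fold `Option`), `optCylPow P k = P × 2^k`, `triW_nonneg_optCylPow` (cylinder closure iterated: any number of dummy
  coordinates) and `triW_nonneg_optCylPow_coatomFamily` (all cylinders over the co-atom stratum, every dimension). [this work]

### The easy converse: `TriWIneq (optCyl P) → TriWIneq P` on the same index cube -/

/-- The cylinder lift of a family of the small fibre cube: `cylFam F x = optCyl (F x)`. [this work] -/
def cylFam (F : Finset β → Finset (Finset γ)) : Finset β → Finset (Finset (Option γ)) := fun x => optCyl (F x)

omit [Fintype β] [DecidableEq β] in
/-- Both sections of a cylinder lift are the original family member. [this work] -/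
theorem optLo_cylFam (F : Finset β → Finset (Finset γ)) (x : Finset β) : optLo (cylFam F x) = F x := optLo_optCyl (F x)

omit [Fintype β] [DecidableEq β] in
/-- The upper section of a cylinder lift. [this work] -/
theorem optHi_cylFam (F : Finset β → Finset (Finset γ)) (x : Finset β) : optHi (cylFam F x) = F x := optHi_optCyl (F x)

omit [Fintype β] [DecidableEq β] in
/-- The cylinder lift of a family of up-sets is a family of up-sets. [this work] -/
theorem isUpperSet_cylFam {F : Finset β → Finset (Finset γ)} (hF : ∀ x, IsUpperSet (F x : Set (Finset γ))) (x : Finset β) :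
    IsUpperSet (cylFam F x : Set (Finset (Option γ))) := isUpperSet_optCyl (hF x)

omit [Fintype β] [DecidableEq β] in
/-- The cylinder lift of a monotone family is monotone. [this work] -/
theorem monotone_cylFam {F : Finset β → Finset (Finset γ)} (hFm : Monotone F) : Monotone (cylFam F) := by
  intro x y hxy t ht
  unfold cylFam at ht ⊢
  rw [mem_optCyl] at ht ⊢
  exact hFm hxy ht

omit [Fintype β] [DecidableEq β] in
/-- `refl` commutes with the cylinder lift. [this work] -/
theorem refl_cylFam (F : Finset β → Finset (Finset γ)) (x : Finset β) : refl (cylFam F x) = optCyl (refl (F x)) := refl_optCyl (F x)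

/-- **Doubling identity**: on cylinder-lifted families the functional of the cylinder is twice the functional of the base:
`triW (optCyl P) (cylFam F) (cylFam G) = 2 · triW P F G`. [this work] -/
theorem triW_optCyl_cylFam (P : Finset (Finset γ)) (F G : Finset β → Finset (Finset γ)) :
    triW (optCyl P) (cylFam F) (cylFam G) = 2 * triW P F G := by
  unfold triW
  rw [mul_sum]
  refine sum_congr rfl fun x _ => ?_
  unfold triWTerm
  simp only [cylFam, refl_optCyl, card_optCyl_inter_inter, optLo_optCyl, optHi_optCyl]
  push_cast
  ring

/-- **The easy converse of cylinder closure**: if `0 ≤ triW (optCyl P) F G` for all monotone families of up-sets on a given index cube,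
then `0 ≤ triW P F G` for all monotone families of up-sets on the SAME index cube (apply the hypothesis to the cylinder lifts and halve).
Together with `triW_nonneg_optCyl_of_forall`: over all index cubes, `TriWIneq` holds for `P` iff it holds for `optCyl P`. [this work] -/
theorem triW_nonneg_of_optCyl {P : Finset (Finset γ)}
    (h : ∀ (F' G' : Finset β → Finset (Finset (Option γ))),
      (∀ x, IsUpperSet (F' x : Set (Finset (Option γ)))) → (∀ x, IsUpperSet (G' x : Set (Finset (Option γ)))) →
      Monotone F' → Monotone G' → 0 ≤ triW (optCyl P) F' G')
    (F G : Finset β → Finset (Finset γ))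
    (hF : ∀ x, IsUpperSet (F x : Set (Finset γ))) (hG : ∀ x, IsUpperSet (G x : Set (Finset γ)))
    (hFm : Monotone F) (hGm : Monotone G) :
    0 ≤ triW P F G := by
  have h2 := h (cylFam F) (cylFam G) (isUpperSet_cylFam hF) (isUpperSet_cylFam hG) (monotone_cylFam hFm) (monotone_cylFam hGm)
  rw [triW_optCyl_cylFam] at h2
  linarith

/-! ### Any number of dummy coordinates: the `k`-fold cylinder `P × 2^k` -/

/-- `k`-fold `Option`: the fibre ground type with `k` extra (dummy) coordinates (`OptPow γ 0 = γ`, `OptPow γ (k+1) = Option (OptPow γ k)`). [this work] -/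
def OptPow (γ : Type) : ℕ → Type
  | 0 => γ
  | k + 1 => Option (OptPow γ k)

/-- Decidable equality on `OptPow γ k` (by recursion on `k`). [this work] -/
instance instDecidableEqOptPow (γ : Type) [DecidableEq γ] : (k : ℕ) → DecidableEq (OptPow γ k)
  | 0 => inferInstanceAs (DecidableEq γ)
  | k + 1 => by have := instDecidableEqOptPow γ k; exact inferInstanceAs (DecidableEq (Option (OptPow γ k)))

/-- `OptPow γ k` is a finite type (by recursion on `k`). [this work] -/
instance instFintypeOptPow (γ : Type) [Fintype γ] : (k : ℕ) → Fintype (OptPow γ k)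
  | 0 => inferInstanceAs (Fintype γ)
  | k + 1 => by have := instFintypeOptPow γ k; exact inferInstanceAs (Fintype (Option (OptPow γ k)))

/-- The `k`-fold cylinder `optCylPow P k = P × 2^k ⊆ Finset (OptPow γ k)` (`optCylPow P (k+1) = optCyl (optCylPow P k)`). [this work] -/
def optCylPow (P : Finset (Finset γ)) : (k : ℕ) → Finset (Finset (OptPow γ k))
  | 0 => P
  | k + 1 => optCyl (optCylPow P k)

/-- **Cylinder closure, iterated**: if `0 ≤ triW P F G` for every index cube and all monotone families of up-sets, then the same holds for the
`k`-fold cylinder `P × 2^k`, for every `k` (induction on `k` with `triW_nonneg_optCyl_of_forall`). [this work] -/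
theorem triW_nonneg_optCylPow {P : Finset (Finset γ)}
    (h : ∀ (β' : Type) [DecidableEq β'] [Fintype β'] (F' G' : Finset β' → Finset (Finset γ)),
      (∀ y, IsUpperSet (F' y : Set (Finset γ))) → (∀ y, IsUpperSet (G' y : Set (Finset γ))) →
      Monotone F' → Monotone G' → 0 ≤ triW P F' G') :
    ∀ (k : ℕ) (β' : Type) [DecidableEq β'] [Fintype β'] (F G : Finset β' → Finset (Finset (OptPow γ k))),
      (∀ x, IsUpperSet (F x : Set (Finset (OptPow γ k)))) → (∀ x, IsUpperSet (G x : Set (Finset (OptPow γ k)))) →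
      Monotone F → Monotone G → 0 ≤ triW (optCylPow P k) F G
  | 0 => h
  | k + 1 => fun _ _ _ F G hF hG hFm hGm =>
      triW_nonneg_optCyl_of_forall (P := optCylPow P k) (triW_nonneg_optCylPow h k) F G hF hG hFm hGm

/-- **All cylinders over the co-atom stratum**: for `#γ ≥ 3` and every `k`, the family "at least `#γ − 1` of the first `#γ` coordinates, the last `k`
coordinates free" (`optCylPow (coatomFamily γ) k`) satisfies `TriWIneq` for every index cube — an infinite family of new cells in every dimension
`#γ + k`, from `triW_nonneg_coatomFamily` and cylinder closure alone. [this work] -/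
theorem triW_nonneg_optCylPow_coatomFamily (hγ : 3 ≤ Fintype.card γ) (k : ℕ) {β' : Type} [DecidableEq β'] [Fintype β']
    (F G : Finset β' → Finset (Finset (OptPow γ k)))
    (hF : ∀ x, IsUpperSet (F x : Set (Finset (OptPow γ k)))) (hG : ∀ x, IsUpperSet (G x : Set (Finset (OptPow γ k))))
    (hFm : Monotone F) (hGm : Monotone G) :
    0 ≤ triW (optCylPow (coatomFamily γ) k) F G :=
  triW_nonneg_optCylPow (fun _ _ _ F' G' hF' hG' hF'm hG'm => triW_nonneg_coatomFamily hγ F' G' hF' hG' hF'm hG'm) k β' F G hF hG hFm hGm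

end FiveUpSet

end Summit.CriticalPhenomena.PercolationContinuityZ3.Theorems
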